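import Mathlib
import Summits.Parity.BatemanHorn.Theses.PolynomialMobius
import Summits.Parity.BatemanHorn.Theorems.PolynomialMobiusPolyMobiusTailStubPairSwapCount
import Literature.NumberTheory.Sieve.LinearPairMoebiusMainTerm
import HarnessLib

/-!
# Crux `PolyMobiusTail` (stmt-Parity-0870), line `eta-free-multilinear-window`, stub
# `stub_pair_balanced` — helper 2: the main term of the balanced window is `o(x)`

Lead `prover-line-stmt-Parity-0870-c3-0`, stub-workers W3/W3b.  After the swap (`stub_pairSwapCount`)
and the exact count (`LinearCongruencePair.card_Ioc_filter_pair_eq_saw`) the balanced window sum is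
`(x − n₀) · M(x) + (ψ-sums)` with the MAIN-TERM COEFFICIENT

  `M(x) = Σ_{d ∈ Box(x)} G_x(d) · ρ(d)/(d₀d₁)`,   `ρ(d) = #{n mod d₀d₁ : d₀ ∣ f₀(n), d₁ ∣ f₁(n)}`,

`G_x(d) = [x^{1−η} < d₀d₁ ≤ x^{1+θ}] [x^σ < min dᵢ] μ(d₀) log d₀ μ(d₁) log d₁`.  This file proves
`M(x) → 0` (aux stub `stub_pairMainTermTendsto`) for EVERY `σ > 0` and all real `θ, η`, by reading
off the pair data `qᵢ = leadingCoeff`, `aᵢ = coeff 0` (`PairLinear.*`) and applying the Literature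
bound `LinearPairMoebius.abs_doubleSum_le` (`|M(x)| ≪ 1/log x`, Siegel–Walfisz strength).
-/

open scoped BigOperators ArithmeticFunction.Moebius
open Filter Finset Polynomial Asymptotics

namespace Summit.Parity.BatemanHorn.Theorems.PolyMobiusTail.EtaFreeWindow

open Literature.NumberTheory.Sieve Literature.NumberTheory.Sieve.LinearCongruencePair
open PairLinear LinearPairMoebius in
/-- **The main-term coefficient of the balanced window tends to `0` (aux stub
`stub_pairMainTermTendsto`, helper 2 of `stub_pair_balanced`).**  For a Bateman–Horn pair of degree
`≤ 1`, every `σ > 0` and all real `θ, η`,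
`M(x) = Σ_{d ∈ [1,f₀(x)⁺]×[1,f₁(x)⁺]} G_x(d) · ρ(d)/(d₀d₁) → 0` (`x → ∞`), where
`G_x(d) = [x^{1−η} < d₀d₁ ≤ x^{1+θ}][x^σ < min dᵢ] μ(d₀) log d₀ μ(d₁) log d₁` and
`ρ(d) = #{n < d₀d₁ : dᵢ ∣ fᵢ(n)}`.  Indeed `|M(x)| ≪_{f,σ} 1/log x`: Siegel–Walfisz cancellation in the
`d₁`-sum for each `d₀` (`LinearPairMoebius.abs_inner_le`) and `Σ_{d₀} log d₀ 4^{ω(d₀)}/d₀ ≪ (log x)^5`.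
[folklore] -/
theorem stub_pairMainTermTendsto : ∀ (f : Fin 2 → ℤ[X]), IsBatemanHornSystem f →
    (∀ i, (f i).natDegree ≤ 1) → ∀ σ θ η : ℝ, 0 < σ →
    Filter.Tendsto (fun x : ℕ =>
      ∑ d ∈ Fintype.piFinset (fun i => Finset.Icc 1 (((f i).eval (x : ℤ)).toNat)),
        (if (x : ℝ) ^ (1 - η) < ∏ i, (d i : ℝ) ∧ ∏ i, (d i : ℝ) ≤ (x : ℝ) ^ (1 + θ) ∧
              (x : ℝ) ^ σ < ((min (d 0) (d 1) : ℕ) : ℝ) then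
            ∏ i, ((ArithmeticFunction.moebius (d i) : ℝ) * Real.log (d i)) else 0) *
          ((((Finset.range (∏ i, d i)).filter
              (fun n : ℕ => ∀ i, ((d i : ℕ) : ℤ) ∣ (f i).eval (n : ℤ))).card : ℝ) / ∏ i, (d i : ℝ)))
      Filter.atTop (nhds 0) := by
  intro f hf hlin σ θ η hσ
  have hdeg : ∀ i, (f i).natDegree = 1 := natDegree_eq_one hf hlin
  -- the data of the pair
  set q₀ : ℕ := (f 0).leadingCoeff.toNat with hq₀def
  set q₁ : ℕ := (f 1).leadingCoeff.toNat with hq₁def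
  set a₀ : ℤ := (f 0).coeff 0 with ha₀def
  set a₁ : ℤ := (f 1).coeff 0 with ha₁def
  obtain ⟨hq₀pos, hq₀Z⟩ := leadingCoeff_toNat hf 0
  obtain ⟨hq₁pos, hq₁Z⟩ := leadingCoeff_toNat hf 1
  have hc₀ : IsCoprime (q₀ : ℤ) a₀ := by
    rw [hq₀Z]; exact isCoprime_leadingCoeff_coeff_zero hf (hdeg 0)
  have hc₁ : IsCoprime (q₁ : ℤ) a₁ := by
    rw [hq₁Z]; exact isCoprime_leadingCoeff_coeff_zero hf (hdeg 1)
  set Δ : ℤ := (q₁ : ℤ) * a₀ - (q₀ : ℤ) * a₁ with hΔdef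
  have hΔ : Δ ≠ 0 := by
    rw [hΔdef, hq₀Z, hq₁Z]; exact resultant_ne_zero hf hdeg
  set D : ℕ := Δ.natAbs with hDdef
  have heval : ∀ (i : Fin 2) (n : ℤ), (f i).eval n = (f i).leadingCoeff * n + (f i).coeff 0 :=
    fun i n => eval_eq (hdeg i) n
  -- the Siegel–Walfisz tails
  obtain ⟨C₁, hC₁0, hC₁⟩ := MoebiusCoprimeTail.abs_sum_Ioc_coprime_moebius_div_le
    (B := 6) (by norm_num)
  obtain ⟨C₂, hC₂0, hC₂⟩ := MoebiusCoprimeTail.abs_sum_Ioc_coprime_moebius_mul_log_div_le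
    (B := 6) (by norm_num)
  set K' : ℝ := (D.divisors.card : ℝ) * (C₁ * Real.log D + C₂) * (4 : ℝ) ^ q₁.primeFactors.card *
    (2 / σ) ^ (6 : ℝ) * 3 ^ 5 with hK'def
  -- the eventual range of `x`
  have hev₁ : ∀ᶠ x : ℕ in atTop, (2 : ℝ) * D ≤ (x : ℝ) ^ σ :=
    ((tendsto_rpow_atTop hσ).comp tendsto_natCast_atTop_atTop).eventually_ge_atTop _
  have hev₂ : ∀ᶠ x : ℕ in atTop, (D : ℝ) ≤ (x : ℝ) ^ (σ / 2) :=
    ((tendsto_rpow_atTop (by linarith)).comp tendsto_natCast_atTop_atTop).eventually_ge_atTop _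
  have hev₃ : ∀ᶠ x : ℕ in atTop, 3 ≤ x := eventually_ge_atTop 3
  have hev₄ : ∀ᶠ x : ℕ in atTop, q₀ + a₀.natAbs ≤ x := eventually_ge_atTop _
  have hbound : ∀ᶠ x : ℕ in atTop,
      ‖∑ d ∈ Fintype.piFinset (fun i => Finset.Icc 1 (((f i).eval (x : ℤ)).toNat)),
        (if (x : ℝ) ^ (1 - η) < ∏ i, (d i : ℝ) ∧ ∏ i, (d i : ℝ) ≤ (x : ℝ) ^ (1 + θ) ∧
              (x : ℝ) ^ σ < ((min (d 0) (d 1) : ℕ) : ℝ) then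
            ∏ i, ((ArithmeticFunction.moebius (d i) : ℝ) * Real.log (d i)) else 0) *
          ((((Finset.range (∏ i, d i)).filter
              (fun n : ℕ => ∀ i, ((d i : ℕ) : ℤ) ∣ (f i).eval (n : ℤ))).card : ℝ) / ∏ i, (d i : ℝ))‖ ≤
        K' / Real.log x := by
    filter_upwards [hev₁, hev₂, hev₃, hev₄] with x hx₁ hx₂ hx₃ hx₄
    have hx3 : (3 : ℝ) ≤ x := by exact_mod_cast hx₃
    have hx0 : (0 : ℝ) < x := by linarith
    set B : Fin 2 → ℕ := fun i => ((f i).eval (x : ℤ)).toNat with hBdef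
    -- Step 1: the summand on the box
    have hsummand : ∀ d ∈ Fintype.piFinset (fun i => Finset.Icc 1 (B i)),
        (if (x : ℝ) ^ (1 - η) < ∏ i, (d i : ℝ) ∧ ∏ i, (d i : ℝ) ≤ (x : ℝ) ^ (1 + θ) ∧
              (x : ℝ) ^ σ < ((min (d 0) (d 1) : ℕ) : ℝ) then
            ∏ i, ((ArithmeticFunction.moebius (d i) : ℝ) * Real.log (d i)) else 0) *
          ((((Finset.range (∏ i, d i)).filter
              (fun n : ℕ => ∀ i, ((d i : ℕ) : ℤ) ∣ (f i).eval (n : ℤ))).card : ℝ) / ∏ i, (d i : ℝ)) =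
        (μ (d 0) : ℝ) * Real.log (d 0) / (d 0) * ((if Nat.Coprime (d 0) q₀ then (1 : ℝ) else 0) *
          (if (x : ℝ) ^ (1 - η) < (d 0 : ℝ) * (d 1) ∧ (d 0 : ℝ) * (d 1) ≤ (x : ℝ) ^ (1 + θ) ∧
              (x : ℝ) ^ σ < (d 0 : ℝ) ∧ (x : ℝ) ^ σ < (d 1 : ℝ) then
            (if Nat.Coprime (d 1) q₁ ∧ ((Nat.gcd (d 0) (d 1) : ℕ) : ℤ) ∣ Δ then
              (μ (d 1) : ℝ) * Real.log (d 1) * ((Nat.gcd (d 0) (d 1) : ℝ) / (d 1)) else 0)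
            else 0)) := by
      intro d hd
      rw [Fintype.mem_piFinset] at hd
      have hd0 : 0 < d 0 := (Finset.mem_Icc.1 (hd 0)).1
      have hd1 : 0 < d 1 := (Finset.mem_Icc.1 (hd 1)).1
      have hd0R : (0 : ℝ) < d 0 := by exact_mod_cast hd0
      have hd1R : (0 : ℝ) < d 1 := by exact_mod_cast hd1
      -- the local count
      have hset : (Finset.range (∏ i, d i)).filter
          (fun n : ℕ => ∀ i, ((d i : ℕ) : ℤ) ∣ (f i).eval (n : ℤ)) =
          (Finset.range (d 0 * d 1)).filter (fun n : ℕ =>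
            ((d 0 : ℕ) : ℤ) ∣ (q₀ : ℤ) * n + a₀ ∧ ((d 1 : ℕ) : ℤ) ∣ (q₁ : ℤ) * n + a₁) := by
        rw [Fin.prod_univ_two]
        refine Finset.filter_congr fun n _ => ?_
        rw [Fin.forall_fin_two, heval 0, heval 1, hq₀Z, hq₁Z]
      have hρ : ((((Finset.range (∏ i, d i)).filter
          (fun n : ℕ => ∀ i, ((d i : ℕ) : ℤ) ∣ (f i).eval (n : ℤ))).card : ℕ) : ℝ) =
          if Nat.Coprime (d 0) q₀ ∧ Nat.Coprime (d 1) q₁ ∧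
            ((Nat.gcd (d 0) (d 1) : ℕ) : ℤ) ∣ (q₁ : ℤ) * a₀ - (q₀ : ℤ) * a₁
          then (Nat.gcd (d 0) (d 1) : ℝ) else 0 := by
        rw [hset, card_range_filter_pair hc₀ hc₁ hd0 hd1]
      rw [hρ, Fin.prod_univ_two, Fin.prod_univ_two, Nat.cast_min]
      by_cases hW : (x : ℝ) ^ (1 - η) < (d 0 : ℝ) * (d 1) ∧ (d 0 : ℝ) * (d 1) ≤ (x : ℝ) ^ (1 + θ) ∧
          (x : ℝ) ^ σ < (d 0 : ℝ) ∧ (x : ℝ) ^ σ < (d 1 : ℝ)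
      · have hW' : (x : ℝ) ^ (1 - η) < (d 0 : ℝ) * (d 1) ∧ (d 0 : ℝ) * (d 1) ≤ (x : ℝ) ^ (1 + θ) ∧
            (x : ℝ) ^ σ < min (d 0 : ℝ) (d 1 : ℝ) := ⟨hW.1, hW.2.1, lt_min hW.2.2.1 hW.2.2.2⟩
        rw [if_pos hW', if_pos hW]
        by_cases hc : Nat.Coprime (d 0) q₀
        · rw [if_pos hc]
          by_cases hc' : Nat.Coprime (d 1) q₁ ∧ ((Nat.gcd (d 0) (d 1) : ℕ) : ℤ) ∣ Δ
          · rw [if_pos ⟨hc, hc'⟩, if_pos hc']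
            field_simp
          · rw [if_neg (fun h => hc' h.2), if_neg hc']
            simp
        · rw [if_neg hc, if_neg (fun h => hc h.1)]
          simp
      · have hW' : ¬ ((x : ℝ) ^ (1 - η) < (d 0 : ℝ) * (d 1) ∧ (d 0 : ℝ) * (d 1) ≤ (x : ℝ) ^ (1 + θ) ∧
            (x : ℝ) ^ σ < min (d 0 : ℝ) (d 1 : ℝ)) := by
          rintro ⟨h1, h2, h3⟩
          exact hW ⟨h1, h2, (lt_min_iff.1 h3).1, (lt_min_iff.1 h3).2⟩
        rw [if_neg hW', if_neg hW]
        simp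
    rw [Real.norm_eq_abs, Finset.sum_congr rfl hsummand, sum_piFinset_two]
    simp only [Matrix.cons_val_zero, Matrix.cons_val_one]
    -- the box side `B 0 ≤ x²`
    have hB0 : ((B 0 : ℕ) : ℝ) ≤ (x : ℝ) ^ 2 := by
      -- `f₀(x)⁺ ≤ q₀ x + |a₀| ≤ (q₀ + |a₀|) x ≤ x²`
      have h1 : ((B 0 : ℕ) : ℤ) ≤ (q₀ : ℤ) * x + a₀.natAbs := by
        simp only [hBdef]
        rw [heval 0, ← hq₀Z]
        have : (f 0).coeff 0 ≤ (a₀.natAbs : ℤ) := by rw [ha₀def]; exact Int.le_natAbs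
        rcases le_or_gt 0 ((q₀ : ℤ) * (x : ℤ) + (f 0).coeff 0) with h | h
        · rw [Int.toNat_of_nonneg h]; linarith
        · rw [Int.toNat_eq_zero.2 h.le]; push_cast; positivity
      have h2 : ((B 0 : ℕ) : ℝ) ≤ (q₀ : ℝ) * x + a₀.natAbs := by exact_mod_cast h1
      have h3 : (q₀ : ℝ) + a₀.natAbs ≤ x := by exact_mod_cast hx₄
      have h4 : (q₀ : ℝ) * x + a₀.natAbs ≤ ((q₀ : ℝ) + a₀.natAbs) * x := by
        have : (a₀.natAbs : ℝ) * 1 ≤ (a₀.natAbs : ℝ) * x :=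
          mul_le_mul_of_nonneg_left (by linarith) (Nat.cast_nonneg _)
        nlinarith
      calc ((B 0 : ℕ) : ℝ) ≤ ((q₀ : ℝ) + a₀.natAbs) * x := h2.trans h4
        _ ≤ x * x := mul_le_mul_of_nonneg_right h3 hx0.le
        _ = (x : ℝ) ^ 2 := by ring
    exact abs_doubleSum_le q₀ hq₁pos hΔ hC₁0 hC₂0 hC₁ hC₂ hσ θ η hx₃ hx₁ hx₂ hB0 (B 1)
  -- conclude
  refine squeeze_zero_norm' hbound ?_
  have hlog : Tendsto (fun x : ℕ => Real.log x) atTop atTop :=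
    Real.tendsto_log_atTop.comp tendsto_natCast_atTop_atTop
  have h := (tendsto_inv_atTop_zero.comp hlog).const_mul K'
  rw [mul_zero] at h
  refine h.congr fun x => ?_
  simp only [Function.comp, div_eq_mul_inv]

end Summit.Parity.BatemanHorn.Theorems.PolyMobiusTail.EtaFreeWindow
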